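import Literature.MathematicalPhysics.QuantumFieldTheory.OSRegularisedGeometric
import Literature.MathematicalPhysics.QuantumFieldTheory.OSSectorContinuation
import HarnessLib

/-!
# The smeared skeleton as bounded sector data: continuation with polynomial growth (OS II (6.13)–(6.15))

Topic `Literature/MathematicalPhysics/QuantumFieldTheory`; support file (all proved; the damped data
as definitions; no named facts) for the temperedness estimate (4.5) of Osterwalder–Schrader II
(Comm. Math. Phys. 42 (1975), Thm. 4.1) **with exponent linear in the number of points and
constants of factorial growth**. Osterwalder–Schrader, Ch. VI.1 (6.13)–(6.15): the smeared skeleton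
`𝒮ᵣ(u)` (the Schwinger function of a cluster of profiles at the skeleton positions, polynomially
bounded in `u`) and its one-variable continuations `E_i(u', τ)` in each slot (bounded through E0'
*uniformly in the right half-plane* by `norm_slotEr_le_geometric`, polynomially in `u'`) are
**damped by the single holomorphic weight `(1 + Σⱼ wⱼ)^{-P}`** (`P = 2M`, total degree linear in
`k` — not a weight per variable), which makes them bounded sector data
(`OSSectorContinuation.IsSectorData` with exponent `0`); the Malgrange–Zerner continuation of the
other unit's engine (`IsSectorData.exists_extension`) and the maximum principle on the flat tubes
(`IsSectorData.norm_extension_le`) bound the damped continuation by the same constant; undoing the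
weight gives the continuation `Gt` of `𝒮ᵣ` with
`‖Gt w‖ ≤ max(C_real, C_slot) · (1 + Σⱼ |wⱼ|)^P` on the sector region of opening `π/4`.

* `norm_skelSVr_le_geometric` — the real bound through geometric profile bounds;
* `dampS`, `dampE` of this file (`smearDampS`, `smearDampE`) and `isSectorData_smearDamp`;
* `exists_smeared_extension` — the continuation with the polynomial bound.

## References

* K. Osterwalder, R. Schrader, *Axioms for Euclidean Green's functions II*, Comm. Math. Phys. 42
  (1975) 281–305, Ch. VI.1 (6.8)–(6.15). [OsterwalderSchraderCMP1975]
-/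

noncomputable section

open MeasureTheory Complex Set Metric Filter
open _root_.Topology
open scoped InnerProductSpace RealInnerProductSpace SchwartzMap NNReal Real

namespace Literature.MathematicalPhysics.QuantumFieldTheory

open Literature.MathematicalPhysics.QuantumLattice (SchwingerFamily IsPositiveTimeMulti schwartzNorm)
open Literature.MathematicalPhysics.QuantumLattice.SchwingerFamily
open Literature.MathematicalPhysics.QuantumLattice.SchwingerFamily.OSSpace
open Literature.Analysis.FunctionSpaces.SchwartzAverage
open Literature.Analysis.Distribution
open Literature.Analysis.Complex
open OSFrames LogSlot OSEnvelope

variable {d : ℕ} [NeZero d]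

/-! ### Elementary inequalities on the orthant -/

omit [NeZero d] in
/-- On the closed orthant the sup norm is at most the sum. [folklore] -/
theorem norm_le_sum_of_nonneg {n : ℕ} {v : Fin n → ℝ} (hv : ∀ j, 0 ≤ v j) : ‖v‖ ≤ ∑ j, v j := by
  refine (pi_norm_le_iff_of_nonneg (Finset.sum_nonneg fun j _ => hv j)).2 fun j => ?_
  rw [Real.norm_eq_abs, abs_of_nonneg (hv j)]
  exact Finset.single_le_sum (fun i _ => hv i) (Finset.mem_univ j)

omit [NeZero d] in
/-- `(1 + ‖v‖)^s ≤ (1 + Σ v)^P` on the closed orthant for `s ≤ P`. [folklore] -/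
theorem one_add_norm_pow_le {n : ℕ} {v : Fin n → ℝ} (hv : ∀ j, 0 ≤ v j) {s P : ℕ} (hsP : s ≤ P) :
    (1 + ‖v‖) ^ s ≤ (1 + ∑ j, v j) ^ P := by
  have h1 : 1 + ‖v‖ ≤ 1 + ∑ j, v j := by linarith [norm_le_sum_of_nonneg hv]
  have h2 : (1 : ℝ) ≤ 1 + ∑ j, v j := by linarith [Finset.sum_nonneg fun j (_ : j ∈ Finset.univ) => hv j]
  exact (pow_le_pow_left₀ (by positivity) h1 s).trans (pow_le_pow_right₀ h2 hsP)

omit [NeZero d] in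
/-- `‖1 + Σ v' + τ‖ ≥ 1 + ‖v'‖` on the closed orthant for `Re τ ≥ 0`. [folklore] -/
theorem one_add_norm_le_norm_damp {n : ℕ} {v' : Fin n → ℝ} (hv : ∀ j, 0 ≤ v' j) {τ : ℂ} (hτ : 0 ≤ τ.re) :
    1 + ‖v'‖ ≤ ‖(1 : ℂ) + ∑ j, (v' j : ℂ) + τ‖ := by
  have hre : ((1 : ℂ) + ∑ j, (v' j : ℂ) + τ).re = 1 + ∑ j, v' j + τ.re := by
    simp [Complex.add_re, Complex.re_sum]
  calc 1 + ‖v'‖ ≤ 1 + ∑ j, v' j + τ.re := by linarith [norm_le_sum_of_nonneg hv]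
    _ = ((1 : ℂ) + ∑ j, (v' j : ℂ) + τ).re := hre.symm
    _ ≤ ‖(1 : ℂ) + ∑ j, (v' j : ℂ) + τ‖ := Complex.re_le_norm _

omit [NeZero d] in
/-- The damping factor does not vanish on the closed orthant for `Re τ ≥ 0`. [folklore] -/
theorem damp_ne_zero {n : ℕ} {v' : Fin n → ℝ} (hv : ∀ j, 0 ≤ v' j) {τ : ℂ} (hτ : 0 ≤ τ.re) :
    (1 : ℂ) + ∑ j, (v' j : ℂ) + τ ≠ 0 := fun h => by
  have h1 := one_add_norm_le_norm_damp hv hτ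
  rw [h, norm_zero] at h1
  linarith [norm_nonneg v']

/-! ### The smeared skeleton: real bound, damped data, continuation -/

section Smeared

variable (𝔖 : SchwingerFamily (EuclideanSpace ℝ (Fin d))) (hE1 : 𝔖.IsEuclideanCovariant)
  (hE2 : 𝔖.IsOSReflectionPositive) {k : ℕ} (φ : Fin (k + 2) → 𝓢(EuclideanSpace ℝ (Fin d), ℂ))
  (ξ : Fin (k + 1) → EuclideanSpace ℝ (Fin d)) (ê : Fin d → EuclideanSpace ℝ (Fin d)) {g r₀ : ℝ}
  (hφ : ∀ j, tsupport (φ j : EuclideanSpace ℝ (Fin d) → ℂ) ⊆ Metric.closedBall 0 r₀)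
  (hê1 : ∀ μ, ‖ê μ‖ = 1) (hêê : ∀ μ ν, 0 ≤ ⟪ê μ, ê ν⟫) (hξ : ∀ μ i', g ≤ ⟪ê μ, ξ i'⟫)
  (hg : 2 * r₀ < g) (hr₀ : 0 ≤ r₀)
  {s : ℕ} {Cv : ℕ → ℝ} (hCv : ∀ n, 0 ≤ Cv n)
  (hv : ∀ (n : ℕ) (K : 𝓢((Fin n → EuclideanSpace ℝ (Fin d)), ℂ)) (hK : IsPositiveTimeMulti K),
    ‖ι 𝔖 hE2 (δ 𝔖 hE2 (mkGen K hK))‖ ≤ Cv n * schwartzNorm ((n + n) * s) K)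
  {M : ℕ} (hM : (k + 1 + (k + 1)) * s ≤ M)
  {s₀ : ℕ} {C₀ : ℝ} (hC₀ : 0 ≤ C₀)
  (hσ : ∀ F : 𝓢((Fin (k + 2) → EuclideanSpace ℝ (Fin d)), ℂ), ‖𝔖 (k + 2) F‖ ≤ C₀ * schwartzNorm s₀ F)
  {a R B : ℝ} (hR : 1 ≤ R) (hB : 0 ≤ B) (ha : 0 ≤ a)
  (hφg : ∀ j, ∀ k' ≤ M, ∀ i' ≤ M, SchwartzMap.seminorm ℝ k' i' (φ j) ≤ a * R ^ k' * B ^ i')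
  (hs₀M : s₀ ≤ M)

/-- **The real constant** `C₀ 2^{s₀+1} skelPosConst^{s₀} · 2^{k+2} a^{k+2} R^{s₀} max(1,(k+2)B)^{s₀}`. [folklore] -/
def smearRealC (k s₀ : ℕ) (C₀ Pc a R B : ℝ) : ℝ :=
  C₀ * (2 ^ (s₀ + 1) * Pc ^ s₀) * (2 ^ (k + 2) * a ^ (k + 2) * R ^ s₀ * max 1 (((k : ℝ) + 2) * B) ^ s₀)

include hC₀ hσ hR hB ha hφg hs₀M in
/-- **The smeared skeleton through geometric profile bounds**:
`‖𝒮ᵣ(v)‖ ≤ smearRealC · (1 + ‖v‖)^{s₀}`. [cite: OsterwalderSchraderCMP1975, Ch. VI.1 (6.13)] -/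
theorem norm_skelSVr_le_geometric (v : Fin (slotK k d + 1) → ℝ) :
    ‖skelSVr 𝔖 φ ξ ê v‖ ≤ smearRealC k s₀ C₀ (skelPosConst ξ ê) a R B * (1 + ‖v‖) ^ s₀ := by
  unfold skelSVr skelSV smearRealC
  refine (hσ _).trans ?_
  have h1 := one_add_norm_posV_le ξ ê (reindexV v)
  rw [norm_reindexV] at h1
  have hφg' : ∀ j, ∀ k' ≤ s₀, ∀ i' ≤ s₀, SchwartzMap.seminorm ℝ k' i' (φ j) ≤ a * R ^ k' * B ^ i' :=
    fun j k' hk' i' hi' => hφg j k' (hk'.trans hs₀M) i' (hi'.trans hs₀M)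
  have htens := schwartzNorm_tensorFin_le_geometric φ hR hB (fun _ => a) (fun _ => ha) hφg'
  rw [Finset.prod_const, Finset.card_univ, Fintype.card_fin] at htens
  have hk2 : (((k + 2 : ℕ) : ℝ)) = (k : ℝ) + 2 := by push_cast; ring
  rw [hk2] at htens
  have hskel := schwartzNorm_skeletonFnV_le (SchwartzMap.tensorFin (k + 2) φ) (posV ξ ê (reindexV v)) s₀
  have hP : 0 ≤ skelPosConst ξ ê * (1 + ‖v‖) := by
    have : (1 : ℝ) ≤ skelPosConst ξ ê := by
      unfold skelPosConst
      have : 0 ≤ (k + 1 : ℝ) * (‖ξ‖ + ∑ μ, ‖ê μ‖) := by positivity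
      linarith
    positivity
  have hG0 : 0 ≤ 2 ^ (k + 2) * a ^ (k + 2) * R ^ s₀ * max 1 (((k : ℝ) + 2) * B) ^ s₀ := by positivity
  calc C₀ * schwartzNorm s₀ (skeletonFnV (SchwartzMap.tensorFin (k + 2) φ) (posV ξ ê (reindexV v)))
      ≤ C₀ * (2 ^ (s₀ + 1) * (1 + ‖posV ξ ê (reindexV v)‖) ^ s₀ * (2 ^ (k + 2) * a ^ (k + 2) * R ^ s₀ * max 1 (((k : ℝ) + 2) * B) ^ s₀)) :=
        mul_le_mul_of_nonneg_left (hskel.trans (mul_le_mul_of_nonneg_left htens (by positivity))) hC₀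
    _ ≤ C₀ * (2 ^ (s₀ + 1) * (skelPosConst ξ ê * (1 + ‖v‖)) ^ s₀ * (2 ^ (k + 2) * a ^ (k + 2) * R ^ s₀ * max 1 (((k : ℝ) + 2) * B) ^ s₀)) := by
        gcongr
    _ = _ := by rw [mul_pow]; ring

/-- **The damped smeared skeleton** `𝒮ᵣ(v) (1 + Σ v)^{-P}`. [cite: OsterwalderSchraderCMP1975, Ch. VI.1 (6.14)] -/
def smearDampS (P : ℕ) (v : Fin (slotK k d + 1) → ℝ) : ℂ :=
  skelSVr 𝔖 φ ξ ê v * ((((1 + ∑ j, v j) ^ P : ℝ) : ℂ))⁻¹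

/-- **The damped slot continuations** `E_i(v', τ) (1 + Σ v' + τ)^{-P}`. [cite: OsterwalderSchraderCMP1975, Ch. VI.1 (6.14)] -/
def smearDampE (P : ℕ) (i : Fin (slotK k d + 1)) (v' : Fin (slotK k d) → ℝ) (τ : ℂ) : ℂ :=
  slotEr 𝔖 hE1 hE2 φ ξ ê hφ hê1 hêê hξ hg hr₀ i v' τ * (((1 : ℂ) + ∑ j, (v' j : ℂ) + τ) ^ P)⁻¹

/-- **The slot constant** `geomProf · Σⱼ unitSlotC j`. [folklore] -/
def smearSlotC (k M : ℕ) (a R B : ℝ) (Csl : Fin (slotK k d + 1) → ℝ) : ℝ := geomProf k M a R B * ∑ j, Csl j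

include hC₀ hσ hR hB ha hφg hs₀M hCv hv hM in
/-- **The damped data are bounded sector data of opening `π/2`.** [cite: OsterwalderSchraderCMP1975, Ch. VI.1 (6.13)–(6.14)] -/
theorem isSectorData_smearDamp :
    IsSectorData (π / 2) (smearDampS 𝔖 φ ξ ê (M + M)) (smearDampE 𝔖 hE1 hE2 φ ξ ê hφ hê1 hêê hξ hg hr₀ (M + M))
      (smearRealC k s₀ C₀ (skelPosConst ξ ê) a R B) 0 (fun _ => smearSlotC k M a R B (unitSlotC ξ ê g Cv M)) where
  cont := by
    refine ContinuousOn.mul ((continuous_skelSV 𝔖 φ ξ ê).comp continuous_reindexV).continuousOn ?_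
    refine ContinuousOn.inv₀ (by fun_prop) fun v hv => ?_
    have h : (0 : ℝ) < (1 + ∑ j, v j) ^ (M + M) := pow_pos (by linarith [Finset.sum_nonneg fun j (_ : j ∈ Finset.univ) => (hv j).le]) _
    exact_mod_cast h.ne'
  C₀_nonneg := by
    unfold smearRealC
    have : (1 : ℝ) ≤ skelPosConst ξ ê := by
      unfold skelPosConst
      have : 0 ≤ (k + 1 : ℝ) * (‖ξ‖ + ∑ μ, ‖ê μ‖) := by positivity
      linarith
    positivity
  bound := fun v hv => by
    rw [pow_zero, mul_one, smearDampS, norm_mul, norm_inv, Complex.norm_real, Real.norm_eq_abs,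
      abs_of_pos (pow_pos (by linarith [Finset.sum_nonneg fun j (_ : j ∈ Finset.univ) => (hv j).le]) _)]
    have h1 := norm_skelSVr_le_geometric 𝔖 φ ξ ê hC₀ hσ hR hB ha hφg hs₀M v
    have h2 := one_add_norm_pow_le (fun j => (hv j).le) (hs₀M.trans (Nat.le_add_right M M))
    have hpos : (0 : ℝ) < (1 + ∑ j, v j) ^ (M + M) := pow_pos (by linarith [Finset.sum_nonneg fun j (_ : j ∈ Finset.univ) => (hv j).le]) _
    have hC : 0 ≤ smearRealC k s₀ C₀ (skelPosConst ξ ê) a R B := by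
      unfold smearRealC
      have : (1 : ℝ) ≤ skelPosConst ξ ê := by
        unfold skelPosConst
        have : 0 ≤ (k + 1 : ℝ) * (‖ξ‖ + ∑ μ, ‖ê μ‖) := by positivity
        linarith
      positivity
    rw [mul_inv_le_iff₀ hpos]
    calc ‖skelSVr 𝔖 φ ξ ê v‖ ≤ smearRealC k s₀ C₀ (skelPosConst ξ ê) a R B * (1 + ‖v‖) ^ s₀ := h1
      _ ≤ smearRealC k s₀ C₀ (skelPosConst ξ ê) a R B * (1 + ∑ j, v j) ^ (M + M) := mul_le_mul_of_nonneg_left h2 hC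
      _ = _ := by ring
  slot_cont := fun i τ hτ => by
    refine ((continuous_slotEr_left 𝔖 hE1 hE2 ξ ê hê1 hêê hξ hg hr₀ φ hφ i τ).continuousOn).mul ?_
    refine ContinuousOn.inv₀ (by fun_prop) fun v' hv' => pow_ne_zero _ (damp_ne_zero (fun j => (hv' j).le) hτ.1.le)
  slot_holo := fun i v' hv' => by
    refine ((differentiableOn_slotEr 𝔖 hE1 hE2 ξ ê hê1 hêê hξ hg hr₀ φ hφ i v').mono fun τ hτ => hτ.1).mul ?_
    refine DifferentiableOn.inv (by fun_prop) fun τ hτ => pow_ne_zero _ (damp_ne_zero (fun j => (hv' j).le) hτ.1.le)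
  Csec_nonneg := fun _ => by
    unfold smearSlotC
    exact mul_nonneg (geomProf_nonneg k M ha hR) (Finset.sum_nonneg fun j _ => unitSlotC_nonneg ξ ê hCv M j)
  slot_bound := fun i c _ v' τ hv' hτ _ => by
    rw [pow_zero, pow_zero, mul_one, mul_one, smearDampE, norm_mul, norm_inv, norm_pow]
    have h1 := norm_slotEr_le_geometric 𝔖 hE2 ξ ê hE1 hê1 hêê hξ hg hr₀ φ hφ hCv hv hM hR hB ha hφg i v' hτ.le
    have h2 := one_add_norm_le_norm_damp (fun j => (hv' j).le) hτ.le
    have hpos : 0 < ‖(1 : ℂ) + ∑ j, (v' j : ℂ) + τ‖ ^ (M + M) := pow_pos (lt_of_lt_of_le (by positivity) h2) _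
    have hGP := geomProf_nonneg k M ha hR (B := B)
    have hU := unitSlotC_nonneg ξ ê (g := g) hCv M i
    rw [mul_inv_le_iff₀ hpos]
    calc ‖slotEr 𝔖 hE1 hE2 φ ξ ê hφ hê1 hêê hξ hg hr₀ i v' τ‖ ≤ geomProf k M a R B * unitSlotC ξ ê g Cv M i * (1 + ‖v'‖) ^ (M + M) := h1
      _ ≤ geomProf k M a R B * unitSlotC ξ ê g Cv M i * ‖(1 : ℂ) + ∑ j, (v' j : ℂ) + τ‖ ^ (M + M) :=
          mul_le_mul_of_nonneg_left (pow_le_pow_left₀ (by positivity) h2 _) (mul_nonneg hGP hU)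
      _ ≤ smearSlotC k M a R B (unitSlotC ξ ê g Cv M) * ‖(1 : ℂ) + ∑ j, (v' j : ℂ) + τ‖ ^ (M + M) := by
          refine mul_le_mul_of_nonneg_right ?_ (by positivity)
          unfold smearSlotC
          exact mul_le_mul_of_nonneg_left (Finset.single_le_sum (fun j _ => unitSlotC_nonneg ξ ê hCv M j) (Finset.mem_univ i)) hGP
  slot_real := fun i v' hv' x hx => by
    rw [smearDampE, smearDampS, slotEr_ofReal 𝔖 hE1 hE2 ξ ê hê1 hêê hξ hg hr₀ φ hφ i v' (fun l => (hv' l).le) x hx.le]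
    congr 1
    rw [Fin.sum_insertNth]
    push_cast
    ring

include hE1 hφ hê1 hêê hξ hg hr₀ hC₀ hσ hR hB ha hφg hs₀M hCv hv hM in
/-- **The continuation of the smeared skeleton with polynomial growth** (OS II (6.13)–(6.15)): there
is `Gt` holomorphic on the sector region of opening `π/2`, equal to `𝒮ᵣ` at the positive real
points, with `‖Gt w‖ ≤ max(C_real, C_slot) · (1 + Σⱼ ‖wⱼ‖)^{2M}` on the sector region of opening
`π/4`. [cite: OsterwalderSchraderCMP1975, Ch. VI.1 (6.13)–(6.15)] -/
theorem exists_smeared_extension :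
    ∃ Gt : (Fin (slotK k d + 1) → ℂ) → ℂ, DifferentiableOn ℂ Gt (sectorRegion (slotK k d) (π / 2)) ∧
      (∀ u : Fin (slotK k d + 1) → ℝ, (∀ j, 0 < u j) → Gt (fun j => (u j : ℂ)) = skelSVr 𝔖 φ ξ ê u) ∧
      ∀ w ∈ sectorRegion (slotK k d) (π / 4),
        ‖Gt w‖ ≤ max (smearRealC k s₀ C₀ (skelPosConst ξ ê) a R B) (smearSlotC k M a R B (unitSlotC ξ ê g Cv M)) *
          (1 + ∑ j, ‖w j‖) ^ (M + M) := by
  have hsd := isSectorData_smearDamp 𝔖 hE1 hE2 φ ξ ê hφ hê1 hêê hξ hg hr₀ hCv hv hM hC₀ hσ hR hB ha hφg hs₀M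
  have hπ2 : (0 : ℝ) < π / 2 := by positivity
  obtain ⟨G, hG, hGreal⟩ := hsd.exists_extension hπ2 le_rfl
  set Cm : ℝ := max (smearRealC k s₀ C₀ (skelPosConst ξ ê) a R B) (smearSlotC k M a R B (unitSlotC ξ ê g Cv M)) with hCm
  -- the maximum principle for the bounded damped data
  have hbd : ∀ w ∈ sectorRegion (slotK k d) (π / 4), ‖G w‖ ≤ Cm := fun w hw =>
    hsd.norm_extension_le le_rfl hG hGreal (by positivity) (by linarith [Real.pi_pos])
      (fun u hu => by
        have h := hsd.bound u hu
        rw [pow_zero, mul_one] at h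
        exact h.trans (le_max_left _ _))
      (fun i u' τ hu hτ hτc => by
        have h := hsd.slot_bound i (π / 4) (by linarith [Real.pi_pos]) u' τ hu hτ hτc
        rw [pow_zero, pow_zero, mul_one, mul_one] at h
        exact h.trans (le_max_right _ _)) hw
  -- undo the damping
  set D : (Fin (slotK k d + 1) → ℂ) → ℂ := fun w => ((1 : ℂ) + ∑ j, w j) ^ (M + M) with hD
  have hDd : Differentiable ℂ D := by fun_prop
  refine ⟨fun w => G w * D w, hG.mul hDd.differentiableOn, fun u hu => ?_, fun w hw => ?_⟩
  · -- real values
    show G (fun j => (u j : ℂ)) * D (fun j => (u j : ℂ)) = skelSVr 𝔖 φ ξ ê u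
    rw [hGreal u hu, smearDampS]
    have hpos : (0 : ℝ) < (1 + ∑ j, u j) ^ (M + M) := pow_pos (by linarith [Finset.sum_nonneg fun j (_ : j ∈ Finset.univ) => (hu j).le]) _
    have hDu : D (fun j => (u j : ℂ)) = ((((1 + ∑ j, u j) ^ (M + M) : ℝ)) : ℂ) := by
      simp only [hD]; push_cast; rfl
    rw [hDu, mul_assoc, inv_mul_cancel₀ (by exact_mod_cast hpos.ne'), mul_one]
  · -- the bound
    rw [norm_mul]
    have hDn : ‖D w‖ ≤ (1 + ∑ j, ‖w j‖) ^ (M + M) := by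
      simp only [hD, norm_pow]
      refine pow_le_pow_left₀ (norm_nonneg _) ?_ _
      calc ‖(1 : ℂ) + ∑ j, w j‖ ≤ ‖(1 : ℂ)‖ + ‖∑ j, w j‖ := norm_add_le _ _
        _ ≤ 1 + ∑ j, ‖w j‖ := by rw [norm_one]; exact add_le_add le_rfl (norm_sum_le _ _)
    have hCm0 : 0 ≤ Cm := (norm_nonneg _).trans (hbd w hw)
    exact mul_le_mul (hbd w hw) hDn (norm_nonneg _) hCm0

end Smeared

end Literature.MathematicalPhysics.QuantumFieldTheory
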